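import Summits.ValiantsHypothesis.ValiantsHypothesis.Theorems.MonotoneRestorationOrbitRestorationQPExplicitToPDClass
import Summits.ValiantsHypothesis.ValiantsHypothesis.Theorems.MonotoneRestorationOrbitRestorationQPSymmetricTerms
import Summits.ValiantsHypothesis.ValiantsHypothesis.Theorems.MonotoneRestorationOrbitRestorationQPValueOrbitDivisionAlgebra
import Summits.ValiantsHypothesis.ValiantsHypothesis.Theorems.MonotoneRestorationOrbitRestorationQPRowColumnStratum
import HarnessLib

/-!
# Route MonotoneRestoration — crux `OrbitRestorationQP` (stmt-ValiantsHypothesis-18293), line `depth_three_rung`: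
# SHPILKA'S SYMMETRIC MODEL as a typed sub-rung of `A_∞` (`stub_sigmaPiSigmaValue`)

Helper file (`--supports stmt-ValiantsHypothesis-18293`), def-free.  Namespace
`Summit.ValiantsHypothesis.ValiantsHypothesis.Theorems.OrbitRestorationQPDepthThreeRung.SymmetricModel`.

The SYMMETRIC MODEL of Shpilka (JCSS 65 (2002), the "Ben-Or closure" of depth three): a polynomial is given at
level `n` as `a · e_d(Y)` — the `d`-th elementary symmetric polynomial (`Multiset.esymm`) of a multiset `Y` of at most
`n^c + c` polynomials of total degree `≤ 1` (an affine FRAME; repetitions allowed).  By Ben-Or's interpolation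
(Shpilka 2002, Thm 3.1) the symmetric model sits inside polynomial-size `ΣΠΣ`; the converse costs `2^d` (ibid. p. 641)
and an exponential separation is conjectured (ibid. Conjecture 3.1), so
  `ΠΣ` (A₁, landed) ⊆ symmetric model ⊆ `ΣΠΣ` = `PDClass 1` (A_∞, open)
is a GENUINELY intermediate rung of the line's ladder, not registered so far.  This file types it and proves its
calibrations in the kernel:

* `prod_map_C_add_eq_sum` — the interpolation node `Π_{y ∈ Y} (t + y) = Σ_j t^j · e_{|Y|-j}(Y)` (Vieta, evaluated);
* `esymm_eq_sum_inv_vandermonde` / `esymm_eq_sum_prod` — BEN-OR IN THE KERNEL: `e_d(Y) = Σ_i (V⁻¹)_{|Y|-d, i} · Π_y (t_i + y)`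
  for any `|Y| + 1` distinct scalars `t_i` (`V` their Vandermonde matrix);
* `pdClass_one_C_mul_esymm` — **symmetric model ⊆ `PDClass 1`, uniformly**: `a · e_d(Y) ∈ PDClass 1 n c'` with
  `c' = 2(2(c+2)+8) + 3^(2(c+2)+8)` depending on `c` only (all `n`, `a`, `d`, frames `Y` of `≤ n^c + c` affine forms);
* `symmetricModel_of_sigmaPiSigmaValue` — **ON-PATH**: the registered stub A_∞ (verbatim) implies the symmetric-model
  rung "every matrix-symmetric family given levelwise as `a · e_d(Y)`, `|Y| ≤ n^c + c` affine, is qp-orbit-restorable";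
* `esymm_card_eq_prod`, `piSigmaValue_of_symmetricModel` — **the rung implies A₁** (`stub_piSigmaValue`, verbatim):
  a scaled affine product is `a · e_{|L|}(L)`;
* `rename_prod_map_C_add`, `qpOrbitRestorable_esymm_of_matrixStable`, `symmetricModel_of_matrixStable` — **TAME FRAMES
  RESTORE, unconditionally and uniformly**: if the frame `Y` is stable under the matrix action `x_pq ↦ x_{σ p, τ q}` (as a
  multiset, e.g. all entries, all row sums, `{x_pq + r_p + c_q}`), every interpolation node `Π_y (t_i + y)` is a
  matrix-symmetric term, so `a · e_d(Y)` is restorable by the landed stratum of kind (S)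
  (`SymmetricTerms.qpOrbitRestorable_of_symmetricTerms`);
* `map_rename_entries`, `qpOrbitRestorable_esymm_entries` — example: `a · e_d(x_11, …, x_nn)` with a uniform constant.

So the CONTENT of the new rung is exactly the WILD FRAMES: matrix-symmetric sections `e_d ∘ ι` of the elementary
symmetric hypersurfaces whose frame is not matrix-stable (they exist cheaply in degree `2` — a Householder-twisted
orthonormal frame has `e_1, e_2` invariant — and in degree `0` — the interpolation identity `Σ_i (V⁻¹)_{m,i} Π_y (t_i + y) = 1`
for ANY frame; whether a wild frame can carry an invariant polynomial with no tame representation is the open question,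
cf. Shpilka 2002 Thms 4.2–4.3 for the structure of `e_d` on subspaces).  Honest label: a new typed sub-rung with its
on-path / floor / tame-case certificates; no registered stub is closed; A_∞, the crux and VP ≠ VNP are NOT moved.

v2 (appended): SUB-QUADRATIC FRAMES ARE TAME BY RANK (`mem_adjoin_rowcol_of_card_lt`, `qpOrbitRestorable_esymm_of_card_lt`,
`sq_le_card_of_not_mem_adjoin_rowcol`): a matrix-symmetric `a · e_d(Y)` on fewer than `(n−1)²`
DISTINCT forms lies in `ℂ[r, c]` and is `QPOrbitRestorable 9 n`; a wild frame with content has `≥ (n−1)²` distinct forms.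

## References
* A. Shpilka, *Affine projections of symmetric polynomials*, J. Comput. System Sci. 65 (2002) 639–659, Thm 3.1
  (Ben-Or), Thm 3.2, Conjecture 3.1. [Shpilka2002]
* M. Ben-Or, cited ibid. as [4] (interpolation of `e_d` from `Π_i (t + L_i)`).
* A. Dawar, G. Wilsenach, *Symmetric arithmetic circuits*, ToC 21 (2025), §3.3 (ORB). [DawarWilsenach2025]
-/

noncomputable section

open scoped Classical

-- `Summit.ValiantsHypothesis.ValiantsHypothesis.…` is the tree's single-conjunct layout (Sub = Summit).
set_option linter.dupNamespace false

namespace Summit.ValiantsHypothesis.ValiantsHypothesis.Theorems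

namespace OrbitRestorationQPDepthThreeRung

namespace SymmetricModel

open MvPolynomial Equiv Finset

variable {n : ℕ}

/-! ### Ben-Or interpolation in the kernel -/

/-- **The interpolation node** (Vieta's formula evaluated at a scalar): for a multiset `Y` of polynomials and a
scalar `t`, `Π_{y ∈ Y} (t + y) = Σ_{j ≤ |Y|} t^j · e_{|Y| - j}(Y)`. [folklore; cite: Shpilka2002, Thm 3.1] -/
theorem prod_map_C_add_eq_sum (Y : Multiset (MvPolynomial (Fin n × Fin n) ℂ)) (t : ℂ) :
    (Y.map fun y => C t + y).prod =
      ∑ j : Fin (Multiset.card Y + 1), t ^ (j : ℕ) • Y.esymm (Multiset.card Y - j) := by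
  have hV := congrArg (Polynomial.eval (C t : MvPolynomial (Fin n × Fin n) ℂ))
    (Multiset.prod_X_add_C_eq_sum_esymm Y)
  rw [Polynomial.eval_multiset_prod, Multiset.map_map, Polynomial.eval_finsetSum] at hV
  have hl : Y.map (Polynomial.eval (C t) ∘ fun r => Polynomial.X + Polynomial.C r) =
      Y.map fun y => C t + y := by
    refine Multiset.map_congr rfl fun y _ => ?_
    simp only [Function.comp_apply, Polynomial.eval_add, Polynomial.eval_X, Polynomial.eval_C]
  rw [hl] at hV
  rw [hV]
  simp only [Polynomial.eval_mul, Polynomial.eval_C, Polynomial.eval_pow, Polynomial.eval_X]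
  rw [← Finset.sum_range_reflect (fun j => Y.esymm j * C t ^ (Multiset.card Y - j)) (Multiset.card Y + 1),
    Finset.sum_range]
  refine Finset.sum_congr rfl fun j _ => ?_
  have hj : (j : ℕ) ≤ Multiset.card Y := by have := j.isLt; omega
  have h1 : Multiset.card Y + 1 - 1 - (j : ℕ) = Multiset.card Y - j := by omega
  have h2 : Multiset.card Y - (Multiset.card Y - (j : ℕ)) = j := Nat.sub_sub_self hj
  simp only [h1, h2]
  rw [smul_eq_C_mul, map_pow, mul_comm]

/-- **BEN-OR'S INTERPOLATION IN THE KERNEL (indexed form).**  For `|Y| + 1` distinct scalars `t_i` with Vandermonde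
matrix `V`, `e_{|Y| - k}(Y) = Σ_i (V⁻¹)_{k i} · Π_{y ∈ Y} (t_i + y)`. [cite: Shpilka2002, Thm 3.1] -/
theorem esymm_eq_sum_inv_vandermonde (Y : Multiset (MvPolynomial (Fin n × Fin n) ℂ))
    (t : Fin (Multiset.card Y + 1) → ℂ) (ht : Function.Injective t) {k : ℕ} (hk : k < Multiset.card Y + 1) :
    Y.esymm (Multiset.card Y - k) =
      ∑ i, C ((Matrix.vandermonde t)⁻¹ ⟨k, hk⟩ i) * (Y.map fun y => C (t i) + y).prod := by
  have key := ValueOrbitDivision.eq_sum_inv_vandermonde (K := ℂ) (M := MvPolynomial (Fin n × Fin n) ℂ) t ht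
    (fun j => Y.esymm (Multiset.card Y - (j : ℕ))) ⟨k, hk⟩
  simp only at key
  rw [key]
  refine Finset.sum_congr rfl fun i _ => ?_
  rw [smul_eq_C_mul, prod_map_C_add_eq_sum]

/-- **BEN-OR'S INTERPOLATION IN THE KERNEL.**  For `d ≤ |Y|` and `|Y| + 1` distinct scalars `t_i`,
`e_d(Y) = Σ_i (V⁻¹)_{|Y| - d, i} · Π_{y ∈ Y} (t_i + y)` — a depth-three expression with `|Y| + 1` product gates of
`|Y|` affine factors each. [cite: Shpilka2002, Thm 3.1] -/
theorem esymm_eq_sum_prod (Y : Multiset (MvPolynomial (Fin n × Fin n) ℂ)) {d : ℕ} (hd : d ≤ Multiset.card Y)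
    (t : Fin (Multiset.card Y + 1) → ℂ) (ht : Function.Injective t) :
    Y.esymm d = ∑ i, C ((Matrix.vandermonde t)⁻¹ ⟨Multiset.card Y - d, by omega⟩ i) *
      (Y.map fun y => C (t i) + y).prod := by
  have h := esymm_eq_sum_inv_vandermonde Y t ht (k := Multiset.card Y - d) (by omega)
  rwa [Nat.sub_sub_self hd] at h

/-- Beyond the size of the frame the elementary symmetric polynomials vanish. [folklore] -/
theorem esymm_eq_zero_of_card_lt (Y : Multiset (MvPolynomial (Fin n × Fin n) ℂ)) {d : ℕ}
    (hd : Multiset.card Y < d) : Y.esymm d = 0 := by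
  rw [Multiset.esymm, Multiset.powersetCard_eq_empty d hd]
  simp

/-- The interpolation nodes `0, 1, …, m` are distinct scalars of `ℂ`. [folklore] -/
theorem natCast_fin_injective (m : ℕ) : Function.Injective fun i : Fin (m + 1) => ((i : ℕ) : ℂ) := by
  intro i j h
  have h' : ((i : ℕ) : ℂ) = ((j : ℕ) : ℂ) := h
  exact Fin.ext (by exact_mod_cast h')

/-- A translate `t + y` of a polynomial of total degree `≤ 1` has total degree `≤ 1`. [folklore] -/
theorem totalDegree_C_add_le {y : MvPolynomial (Fin n × Fin n) ℂ} (hy : y.totalDegree ≤ 1) (t : ℂ) :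
    (C t + y).totalDegree ≤ 1 :=
  (totalDegree_add _ _).trans (max_le (by simp) hy)

/-! ### The symmetric model lies in `PDClass 1`, uniformly (on-path lemma) -/

/-- **SYMMETRIC MODEL ⊆ `PDClass 1`, UNIFORMLY IN THE LEVEL.**  If `Y` is a multiset of at most `n^c + c` polynomials
of total degree `≤ 1`, then for every scalar `a` and every `d`, `a · e_d(Y)` lies in the `ΣΠΣ` slice
`PDClass (fun _ => 1) n c'` with `c' = 2(2(c+2)+8) + 3^(2(c+2)+8)` (Ben-Or interpolation at the nodes `0, …, |Y|`,
then `ExplicitForm.pdClass_one_of_explicit`). [cite: Shpilka2002, Thm 3.1] -/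
theorem pdClass_one_C_mul_esymm {c : ℕ} (Y : Multiset (MvPolynomial (Fin n × Fin n) ℂ))
    (hdeg : ∀ y ∈ Y, y.totalDegree ≤ 1) (hcard : Multiset.card Y ≤ n ^ c + c) (a : ℂ) (d : ℕ) :
    PDClass (fun _ => 1) n (2 * (2 * (c + 2) + 8) + 3 ^ (2 * (c + 2) + 8)) (C a * Y.esymm d) := by
  -- budget bookkeeping `n^c + c + 1 ≤ n^(c+2) + (c+2)` (cf. `TwoIntegralNormalisation.pow_add_add_one_le`)
  have hb : n ^ c + c + 1 ≤ n ^ (c + 2) + (c + 2) := by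
    rcases Nat.eq_zero_or_pos n with rfl | hn
    · rcases Nat.eq_zero_or_pos c with rfl | hc
      · simp
      · rw [zero_pow (by omega), zero_pow (by omega)]; omega
    · have : n ^ c ≤ n ^ (c + 2) := Nat.pow_le_pow_right hn (by omega)
      omega
  by_cases hd : d ≤ Multiset.card Y
  · have ht : Function.Injective fun i : Fin (Multiset.card Y + 1) => ((i : ℕ) : ℂ) :=
      natCast_fin_injective _
    rw [esymm_eq_sum_prod Y hd _ ht, Finset.mul_sum]
    simp_rw [← mul_assoc, ← map_mul]
    refine ExplicitForm.pdClass_one_of_explicit (c := c + 2) (𝒯 := Fin (Multiset.card Y + 1)) ?_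
      (fun i => a * (Matrix.vandermonde fun i : Fin (Multiset.card Y + 1) => ((i : ℕ) : ℂ))⁻¹
        ⟨Multiset.card Y - d, by omega⟩ i)
      (fun i => Y.map fun y => C (((i : ℕ) : ℂ)) + y) ?_ ?_
    · rw [Fintype.card_fin]; omega
    · intro i ℓ hℓ
      obtain ⟨y, hy, rfl⟩ := Multiset.mem_map.mp hℓ
      exact totalDegree_C_add_le (hdeg y hy) _
    · intro i
      rw [Multiset.card_map]; omega
  · rw [esymm_eq_zero_of_card_lt Y (by omega), mul_zero]
    have h := ExplicitForm.pdClass_one_of_explicit (n := n) (c := c + 2) (𝒯 := Fin 0) (by simp)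
      (fun _ => 0) (fun _ => 0) (fun i => i.elim0) (fun i => i.elim0)
    simpa using h

/-- **ON-PATH: `A_∞` IMPLIES THE SYMMETRIC-MODEL RUNG.**  The registered stub `stub_sigmaPiSigmaValue` (verbatim, as
hypothesis) implies: every matrix-symmetric family given at every level as `a · e_d(Y)` for a frame `Y` of at most
`n^c + c` polynomials of total degree `≤ 1` is quasi-polynomially orbit-restorable. [cite: Shpilka2002, Thm 3.1] -/
theorem symmetricModel_of_sigmaPiSigmaValue
    (hA : ∀ f : (n : ℕ) → MvPolynomial (Fin n × Fin n) ℂ, IsMatrixSymmetric f →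
      (∃ c : ℕ, ∀ n : ℕ, PDClass (fun _ => 1) n c (f n)) →
      ∃ c : ℕ, ∀ n : ℕ, QPOrbitRestorable c n (f n)) :
    ∀ f : (n : ℕ) → MvPolynomial (Fin n × Fin n) ℂ, IsMatrixSymmetric f →
      (∃ c : ℕ, ∀ n : ℕ, ∃ (a : ℂ) (d : ℕ) (Y : Multiset (MvPolynomial (Fin n × Fin n) ℂ)),
        (∀ y ∈ Y, y.totalDegree ≤ 1) ∧ Multiset.card Y ≤ n ^ c + c ∧ f n = C a * Y.esymm d) →
      ∃ c : ℕ, ∀ n : ℕ, QPOrbitRestorable c n (f n) := by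
  intro f hsym hY
  obtain ⟨c, hc⟩ := hY
  refine hA f hsym ⟨2 * (2 * (c + 2) + 8) + 3 ^ (2 * (c + 2) + 8), fun n => ?_⟩
  obtain ⟨a, d, Y, hdeg, hcard, hf⟩ := hc n
  rw [hf]
  exact pdClass_one_C_mul_esymm Y hdeg hcard a d

/-! ### The symmetric-model rung implies A₁ (the `ΠΣ` sub-rung) -/

/-- The top elementary symmetric polynomial of a frame is its product: `e_{|Y|}(Y) = Π Y`. [folklore] -/
theorem esymm_card_eq_prod (Y : Multiset (MvPolynomial (Fin n × Fin n) ℂ)) :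
    Y.esymm (Multiset.card Y) = Y.prod := by
  simp [Multiset.esymm, Multiset.powersetCard_self]

/-- **THE SYMMETRIC-MODEL RUNG IMPLIES A₁.**  The registered `stub_piSigmaValue` (verbatim, as conclusion) follows from
the symmetric-model rung: a scaled product of affine forms `a · Π L` is `a · e_{|L|}(L)`. [folklore] -/
theorem piSigmaValue_of_symmetricModel
    (hS : ∀ f : (n : ℕ) → MvPolynomial (Fin n × Fin n) ℂ, IsMatrixSymmetric f →
      (∃ c : ℕ, ∀ n : ℕ, ∃ (a : ℂ) (d : ℕ) (Y : Multiset (MvPolynomial (Fin n × Fin n) ℂ)),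
        (∀ y ∈ Y, y.totalDegree ≤ 1) ∧ Multiset.card Y ≤ n ^ c + c ∧ f n = C a * Y.esymm d) →
      ∃ c : ℕ, ∀ n : ℕ, QPOrbitRestorable c n (f n)) :
    ∀ f : (n : ℕ) → MvPolynomial (Fin n × Fin n) ℂ, IsMatrixSymmetric f →
      (∃ c : ℕ, ∀ n : ℕ, PDClass (fun _ => 1) n c (f n) ∧
        ∃ (a : ℂ) (L : Multiset (MvPolynomial (Fin n × Fin n) ℂ)),
          (∀ ℓ ∈ L, ℓ.totalDegree ≤ 1) ∧ Multiset.card L ≤ n ^ c + c ∧ f n = MvPolynomial.C a * L.prod) →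
      ∃ c : ℕ, ∀ n : ℕ, QPOrbitRestorable c n (f n) := by
  intro f hsym hL
  obtain ⟨c, hc⟩ := hL
  refine hS f hsym ⟨c, fun n => ?_⟩
  obtain ⟨-, a, L, hdeg, hcard, hf⟩ := hc n
  exact ⟨a, Multiset.card L, L, hdeg, hcard, by rw [hf, esymm_card_eq_prod]⟩

/-! ### Tame frames restore: matrix-stable frames give terms of kind (S) -/

/-- Renaming an interpolation node: `ρ(Π_{y ∈ Y} (t + y)) = Π_{y ∈ ρ Y} (t + y)`. [folklore] -/
theorem rename_prod_map_C_add (g : Fin n × Fin n → Fin n × Fin n)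
    (Y : Multiset (MvPolynomial (Fin n × Fin n) ℂ)) (t : ℂ) :
    rename g (Y.map fun y => C t + y).prod = ((Y.map (rename g)).map fun y => C t + y).prod := by
  rw [map_multiset_prod, Multiset.map_map, Multiset.map_map]
  congr 1
  refine Multiset.map_congr rfl fun y _ => ?_
  simp only [Function.comp_apply, map_add, rename_C]

/-- **TAME FRAMES RESTORE (uniform constant).**  For every `c` there is `c'` such that at every level `n`, for every
frame `Y` of at most `n^c + c` polynomials of total degree `≤ 1` which is STABLE, as a multiset, under the matrix action
`x_pq ↦ x_{σ p, τ q}` of every `(σ, τ) ∈ Sym_n × Sym_n`, and every `a`, `d`, the polynomial `a · e_d(Y)` is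
`QPOrbitRestorable c' n`: every interpolation node `Π_y (t_i + y)` is then a matrix-symmetric term, and sums of
matrix-symmetric terms restore (`SymmetricTerms.qpOrbitRestorable_of_symmetricTerms`, the landed stratum (S)).
[folklore; cite: DawarWilsenach2025, §3.3] -/
theorem qpOrbitRestorable_esymm_of_matrixStable (c : ℕ) : ∃ c' : ℕ, ∀ (n : ℕ)
    (Y : Multiset (MvPolynomial (Fin n × Fin n) ℂ)) (a : ℂ) (d : ℕ),
    (∀ y ∈ Y, y.totalDegree ≤ 1) → Multiset.card Y ≤ n ^ c + c →
    (∀ σ τ : Perm (Fin n), Y.map (rename fun q : Fin n × Fin n => (σ q.1, τ q.2)) = Y) →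
    QPOrbitRestorable c' n (C a * Y.esymm d) := by
  obtain ⟨c', hc'⟩ := SymmetricTerms.qpOrbitRestorable_of_symmetricTerms c
  refine ⟨c', fun n Y a d hdeg hcard hstab => ?_⟩
  by_cases hd : d ≤ Multiset.card Y
  · set t : Fin (Multiset.card Y + 1) → ℂ := fun i => ((i : ℕ) : ℂ) with ht_def
    have ht : Function.Injective t := natCast_fin_injective _
    have hrep : C a * Y.esymm d = ∑ i : Fin (Multiset.card Y + 1),
        C (a * (Matrix.vandermonde t)⁻¹ ⟨Multiset.card Y - d, by omega⟩ i) *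
          (Y.map fun y => C (t i) + y).prod := by
      rw [esymm_eq_sum_prod Y hd t ht, Finset.mul_sum]
      refine Finset.sum_congr rfl fun i _ => ?_
      rw [← mul_assoc, ← map_mul]
    refine hc' n _ (Multiset.card Y + 1)
      (fun i => a * (Matrix.vandermonde t)⁻¹ ⟨Multiset.card Y - d, by omega⟩ i)
      (fun i => Y.map fun y => C (t i) + y) ?_ ?_ hrep ?_
    · intro i ℓ hℓ
      obtain ⟨y, hy, rfl⟩ := Multiset.mem_map.mp hℓ
      exact totalDegree_C_add_le (hdeg y hy) _
    · intro i
      rw [Multiset.card_map]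
      exact hcard
    · intro i σ τ
      rw [map_mul, rename_C, rename_prod_map_C_add, hstab σ τ]
  · have h0 : C a * Y.esymm d =
        ∑ i : Fin 0, C ((fun _ => (0 : ℂ)) i) *
          ((fun _ => (0 : Multiset (MvPolynomial (Fin n × Fin n) ℂ))) i).prod := by
      rw [esymm_eq_zero_of_card_lt Y (by omega), mul_zero]
      simp
    exact hc' n _ 0 (fun _ => 0) (fun _ => 0) (fun i => i.elim0) (fun i => i.elim0) h0 (fun i => i.elim0)

/-- **THE SYMMETRIC-MODEL RUNG HOLDS ON TAME FRAMES (family form).**  Every matrix-symmetric family given at every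
level as `a · e_d(Y)` for a MATRIX-STABLE frame `Y` of at most `n^c + c` polynomials of total degree `≤ 1` is
quasi-polynomially orbit-restorable — unconditionally; the open content of the rung is the wild (non-stable) frames.
[folklore; cite: DawarWilsenach2025, §3.3] -/
theorem symmetricModel_of_matrixStable :
    ∀ f : (n : ℕ) → MvPolynomial (Fin n × Fin n) ℂ,
      (∃ c : ℕ, ∀ n : ℕ, ∃ (a : ℂ) (d : ℕ) (Y : Multiset (MvPolynomial (Fin n × Fin n) ℂ)),
        (∀ y ∈ Y, y.totalDegree ≤ 1) ∧ Multiset.card Y ≤ n ^ c + c ∧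
        (∀ σ τ : Perm (Fin n), Y.map (rename fun q : Fin n × Fin n => (σ q.1, τ q.2)) = Y) ∧
        f n = C a * Y.esymm d) →
      ∃ c : ℕ, ∀ n : ℕ, QPOrbitRestorable c n (f n) := by
  intro f hY
  obtain ⟨c, hc⟩ := hY
  obtain ⟨c', hc'⟩ := qpOrbitRestorable_esymm_of_matrixStable c
  refine ⟨c', fun n => ?_⟩
  obtain ⟨a, d, Y, hdeg, hcard, hstab, hf⟩ := hc n
  rw [hf]
  exact hc' n Y a d hdeg hcard hstab

/-! ### Example: the elementary symmetric polynomials of all `n²` entries -/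

/-- The frame of all entries `{x_pq : p, q < n}` is stable under every bijective renaming. [folklore] -/
theorem map_rename_entries (e : Fin n × Fin n ≃ Fin n × Fin n) :
    ((univ : Finset (Fin n × Fin n)).val.map (X : Fin n × Fin n → MvPolynomial (Fin n × Fin n) ℂ)).map
        (rename e) =
      (univ : Finset (Fin n × Fin n)).val.map X := by
  rw [Multiset.map_map]
  have hcomp : (rename e ∘ (X : Fin n × Fin n → MvPolynomial (Fin n × Fin n) ℂ)) = X ∘ e := by
    funext x
    simp only [Function.comp_apply, rename_X]
  rw [hcomp, ← Multiset.map_map, Multiset.map_univ_val_equiv]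

/-- **Example (uniform constant).**  There is `c'` such that for all `n`, `a`, `d`, the polynomial
`a · e_d(x_11, …, x_nn)` — the degree-`d` elementary symmetric polynomial of all `n²` entries — is
`QPOrbitRestorable c' n` (frame of `n² ≤ n² + 2` entries, stable under the matrix action). [folklore] -/
theorem qpOrbitRestorable_esymm_entries : ∃ c' : ℕ, ∀ (n : ℕ) (a : ℂ) (d : ℕ),
    QPOrbitRestorable c' n
      (C a * ((univ : Finset (Fin n × Fin n)).val.map
        (X : Fin n × Fin n → MvPolynomial (Fin n × Fin n) ℂ)).esymm d) := by
  obtain ⟨c', hc'⟩ := qpOrbitRestorable_esymm_of_matrixStable 2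
  refine ⟨c', fun n a d => hc' n _ a d ?_ ?_ ?_⟩
  · intro y hy
    obtain ⟨x, -, rfl⟩ := Multiset.mem_map.mp hy
    exact (totalDegree_X (R := ℂ) x).le
  · rw [Multiset.card_map, Finset.card_val, Finset.card_univ, Fintype.card_prod, Fintype.card_fin, sq]
    exact Nat.le_add_right _ _
  · intro σ τ
    have hfun : (fun q : Fin n × Fin n => (σ q.1, τ q.2)) = ⇑(Equiv.prodCongr σ τ) := by
      funext q
      simp only [Equiv.prodCongr_apply, Prod.map]
    rw [hfun]
    exact map_rename_entries (Equiv.prodCongr σ τ)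

/-! ### v2 — Sub-quadratic frames: fewer than `(n-1)²` distinct forms force `ℂ[r, c]` -/

/-- `e_d(Y)` lies in every subalgebra containing the members of `Y`. [folklore] -/
theorem esymm_mem_adjoin (Y : Multiset (MvPolynomial (Fin n × Fin n) ℂ)) (d : ℕ)
    {A : Subalgebra ℂ (MvPolynomial (Fin n × Fin n) ℂ)} (hY : ∀ y ∈ Y, y ∈ A) : Y.esymm d ∈ A := by
  rw [Multiset.esymm]
  refine Subalgebra.multiset_sum_mem _ fun q hq => ?_
  obtain ⟨s, hs, rfl⟩ := Multiset.mem_map.mp hq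
  refine Subalgebra.multiset_prod_mem _ fun y hy => hY y ?_
  exact Multiset.mem_of_le (Multiset.mem_powersetCard.mp hs).1 hy

/-- **SUB-QUADRATIC FRAMES ARE TAME BY RANK.**  A matrix-symmetric `a · e_d(Y)` whose affine frame `Y` has fewer than
`(n−1)²` DISTINCT members lies in `ℂ[r, c]`: `span(1, Y)` is an admissible space of dimension `≤ (n−1)²`
(`RowColumnDichotomy.mem_adjoin_rowcol_of_admissible`); the threshold is on the FRAME, not on the `|Y|(|Y|+1)` wires of its
Ben-Or expansion. [folklore] -/
theorem mem_adjoin_rowcol_of_card_lt {Y : Multiset (MvPolynomial (Fin n × Fin n) ℂ)}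
    (hdeg : ∀ y ∈ Y, y.totalDegree ≤ 1) (hcard : Y.toFinset.card < (n - 1) ^ 2) (a : ℂ) (d : ℕ)
    (hsym : ∀ σ τ : Perm (Fin n),
      rename (fun q : Fin n × Fin n => (σ q.1, τ q.2)) (C a * Y.esymm d) = C a * Y.esymm d) :
    C a * Y.esymm d ∈ Algebra.adjoin ℂ
      (Set.range (fun i : Fin n => ∑ j : Fin n, (X (i, j) : MvPolynomial (Fin n × Fin n) ℂ)) ∪
        Set.range (fun j : Fin n => ∑ i : Fin n, (X (i, j) : MvPolynomial (Fin n × Fin n) ℂ))) := by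
  set S : Finset (MvPolynomial (Fin n × Fin n) ℂ) := insert (C 1) Y.toFinset with hS
  set Λ : Submodule ℂ (MvPolynomial (Fin n × Fin n) ℂ) :=
    Submodule.span ℂ (S : Set (MvPolynomial (Fin n × Fin n) ℂ)) with hΛ
  haveI : FiniteDimensional ℂ Λ := FiniteDimensional.span_finset ℂ S
  have hdim : Module.finrank ℂ Λ ≤ (n - 1) ^ 2 := by
    refine (finrank_span_finset_le_card S).trans ((Finset.card_insert_le _ _).trans ?_)
    omega
  have hadm : LinearSubalgebra.Admissible (C a * Y.esymm d) Λ := by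
    refine ⟨?_, Submodule.subset_span (by simp [hS]), ?_⟩
    · rw [hΛ, Submodule.span_le]
      intro x hx
      rw [hS, Finset.coe_insert, Set.mem_insert_iff] at hx
      rcases hx with rfl | hx
      · exact LinearSubalgebra.mem_deg1.2 (by rw [totalDegree_C]; exact Nat.zero_le _)
      · rw [Finset.mem_coe, Multiset.mem_toFinset] at hx
        exact LinearSubalgebra.mem_deg1.2 (hdeg x hx)
    · refine Subalgebra.mul_mem _ (Subalgebra.algebraMap_mem _ _) ?_
      refine esymm_mem_adjoin Y d fun y hy => Algebra.subset_adjoin (Submodule.subset_span ?_)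
      rw [hS, Finset.coe_insert]
      exact Set.mem_insert_of_mem _ (by rw [Finset.mem_coe, Multiset.mem_toFinset]; exact hy)
  exact RowColumnDichotomy.mem_adjoin_rowcol_of_admissible hsym hadm hdim

/-- **SUB-QUADRATIC FRAMES RESTORE**, with the absolute constant `9` of the `ℂ[r, c]` stratum
(`RowColumnStratum.qpOrbitRestorable_of_mem_adjoin_rowcol`). [folklore; cite: DawarWilsenach2025, §3.3] -/
theorem qpOrbitRestorable_esymm_of_card_lt {Y : Multiset (MvPolynomial (Fin n × Fin n) ℂ)}
    (hdeg : ∀ y ∈ Y, y.totalDegree ≤ 1) (hcard : Y.toFinset.card < (n - 1) ^ 2) (a : ℂ) (d : ℕ)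
    (hsym : ∀ σ τ : Perm (Fin n),
      rename (fun q : Fin n × Fin n => (σ q.1, τ q.2)) (C a * Y.esymm d) = C a * Y.esymm d) :
    QPOrbitRestorable 9 n (C a * Y.esymm d) :=
  RowColumnStratum.qpOrbitRestorable_of_mem_adjoin_rowcol hsym (mem_adjoin_rowcol_of_card_lt hdeg hcard a d hsym)

/-- **WINDOW FOR THE NEW RUNG**: a matrix-symmetric `a · e_d(Y)` outside `ℂ[r, c]` has a frame with at least `(n−1)²`
distinct members. [folklore] -/
theorem sq_le_card_of_not_mem_adjoin_rowcol {Y : Multiset (MvPolynomial (Fin n × Fin n) ℂ)}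
    (hdeg : ∀ y ∈ Y, y.totalDegree ≤ 1) (a : ℂ) (d : ℕ)
    (hsym : ∀ σ τ : Perm (Fin n),
      rename (fun q : Fin n × Fin n => (σ q.1, τ q.2)) (C a * Y.esymm d) = C a * Y.esymm d)
    (hnot : C a * Y.esymm d ∉ Algebra.adjoin ℂ
      (Set.range (fun i : Fin n => ∑ j : Fin n, (X (i, j) : MvPolynomial (Fin n × Fin n) ℂ)) ∪
        Set.range (fun j : Fin n => ∑ i : Fin n, (X (i, j) : MvPolynomial (Fin n × Fin n) ℂ)))) :
    (n - 1) ^ 2 ≤ Y.toFinset.card := by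
  by_contra h
  exact hnot (mem_adjoin_rowcol_of_card_lt hdeg (by omega) a d hsym)

end SymmetricModel

end OrbitRestorationQPDepthThreeRung

end Summit.ValiantsHypothesis.ValiantsHypothesis.Theorems

end
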